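import Summits.CriticalPhenomena.CardyFormulaZ2.Theorems.CardyFlipRussoQuadrupoleSelectionRulePoissonPerturbationAt

/-!
# Continuity of the annealed observable along the Poisson superposition leg

Helper file for the crux `QuadrupoleSelectionRule` (stmt-CriticalPhenomena-7029, informal) of
route `CardyFlipRusso` (sub-problem `CardyFormulaZ2`), line `Sketch` (generation 3), stub G4:
the annealed observable `t ↦ ∫ F(c ∪ c') d(P ⊗ Q_t)` of the Poisson superposition leg (rest
`c` of any finite law `P`, independent Poisson process `c'` of intensity `t • ρ` with `ρ` finite,
law `Q t`, bounded measurable `F`) is Lipschitz, hence continuous, in the leg parameter `t`.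

Proof. For `t, s ≥ 0` the law `Q (t + s)` is the superposition of independent samples of `Q t`
and `Q s` (`eq_map_union_prod_of_isPoissonPointProcess`, from Kingman's Superposition Theorem and
Rényi uniqueness), so by associativity of superposition (`map_union_prod_map_union`) the
observable at `t + s` is `∫ F(c ∪ c₂) d(P' ⊗ Q_s)` for the rest `P' = (P ⊗ Q_t) ∘ (∪)⁻¹`, while
the observable at `t` is `∫ F(c) d(P' ⊗ Q_s)` (`Q s` is a probability law). Superposing the extra
sample `c₂` changes the configuration only on the event `{c₂ ≠ ∅}`, of probability
`1 - e^{-s ρ(E)} ≤ s ρ(E)` (void probability of a Poisson process,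
`IsPoissonPointProcess.one_sub_measureReal_count_eq_zero_le`), and there by at most `2 sup |F|`;
whence the one-sided Lipschitz bound `abs_integral_union_poisson_sub_le`
(`|f(t + s) - f(t)| ≤ 2 M P(univ) · s ρ(E)`), which gives a Lipschitz bound on `[0, 1]` and the
continuity `continuousOn_integral_union_poisson` — the continuity input of the one-sided
mean-value step `uniform_close_of_deriv_right_bound` of the line.
-/

noncomputable section

open MeasureTheory ProbabilityTheory Filter Set
open scoped ENNReal NNReal Topology

namespace Summit.CriticalPhenomena.CardyFormulaZ2.Theorems

open Literature.Analysis.FunctionSpaces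

section Poisson

variable {E : Type*} [TopologicalSpace E] [T2Space E] [SecondCountableTopology E]
  [MeasurableSpace E] [BorelSpace E]

/-- **One-sided Lipschitz bound for the annealed observable along the superposition leg.** Let
`P` be any finite law of a "rest" configuration, `ρ` a finite measure and `Q t` (for `t ≥ 0`) a
Poisson point process of intensity `t • ρ`. For bounded measurable `F` (`|F| ≤ M`) and
`t, s ≥ 0`,
`|∫ F(c ∪ c') d(P ⊗ Q_{t+s}) - ∫ F(c ∪ c') d(P ⊗ Q_t)| ≤ 2 M · P(univ) · s ρ(univ)`:
`Q_{t+s}` is the superposition of `Q_t` and an independent `Q_s` in law, and the extra sample is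
non-empty with probability `1 - e^{-s ρ(univ)} ≤ s ρ(univ)`. [folklore] -/
theorem abs_integral_union_poisson_sub_le
    (P : Measure (PointConfig E)) [IsFiniteMeasure P]
    (ρ : Measure E) [IsFiniteMeasure ρ]
    (Q : ℝ → Measure (PointConfig E))
    (hQ : ∀ t, 0 ≤ t → IsPoissonPointProcess ((ENNReal.ofReal t) • ρ) (Q t))
    (F : PointConfig E → ℝ) (hFm : Measurable F) (M : ℝ) (hFb : ∀ c, |F c| ≤ M)
    {t s : ℝ} (ht : 0 ≤ t) (hs : 0 ≤ s) :
    |(∫ p, F (p.1 ∪ p.2) ∂(P.prod (Q (t + s)))) - ∫ p, F (p.1 ∪ p.2) ∂(P.prod (Q t))|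
      ≤ 2 * M * P.real univ * (s * ρ.real univ) := by
  have hU : Measurable fun p : PointConfig E × PointConfig E => p.1 ∪ p.2 :=
    PointConfig.measurable_union'
  haveI := (hQ t ht).isProbabilityMeasure
  haveI := (hQ s hs).isProbabilityMeasure
  have hM : 0 ≤ M := (abs_nonneg _).trans (hFb ∅)
  -- the observable is the integral of `F` against the law of the superposition
  have hint : ∀ μ : Measure (PointConfig E × PointConfig E), ∫ p, F (p.1 ∪ p.2) ∂μ =
      ∫ c, F c ∂(μ.map fun p : PointConfig E × PointConfig E => p.1 ∪ p.2) :=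
    fun μ => (integral_map hU.aemeasurable hFm.aestronglyMeasurable).symm
  -- the law of the superposition of the rest and the sample of `Q t`: the new rest
  set P' : Measure (PointConfig E) :=
    (P.prod (Q t)).map fun p : PointConfig E × PointConfig E => p.1 ∪ p.2 with hP'def
  -- the observable at `t + s` is the observable at `s` for the rest `P'`
  have h1 : ∫ p, F (p.1 ∪ p.2) ∂(P.prod (Q (t + s))) =
      ∫ p, F (p.1 ∪ p.2) ∂(P'.prod (Q s)) := by
    rw [hint, hint (P'.prod (Q s)), eq_map_union_prod_of_isPoissonPointProcess ρ hQ ht hs,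
      map_union_prod_map_union P (Q t) (Q s), ← hP'def]
  -- the observable at `t` is the `P' ⊗ Q s`-mean of `F` of the first coordinate
  have h2 : ∫ p, F (p.1 ∪ p.2) ∂(P.prod (Q t)) = ∫ p, F p.1 ∂(P'.prod (Q s)) := by
    rw [hint, ← hP'def, integral_fun_fst, probReal_univ, one_smul]
  -- the total mass of the new rest
  have hP'univ : P'.real univ = P.real univ := by
    rw [hP'def, measureReal_def, measureReal_def, Measure.map_apply hU MeasurableSet.univ,
      Set.preimage_univ, ← Set.univ_prod_univ, Measure.prod_prod, measure_univ (μ := Q t),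
      mul_one]
  -- the event "the extra sample is non-empty" and its probability
  have hAm : MeasurableSet {c : PointConfig E | c.count univ = 0} :=
    PointConfig.measurable_count MeasurableSet.univ (measurableSet_singleton _)
  have hQA : (Q s).real {c : PointConfig E | c.count univ = 0}ᶜ ≤ s * ρ.real univ := by
    have hfin : ((ENNReal.ofReal s) • ρ) univ ≠ ∞ := by
      rw [Measure.smul_apply, smul_eq_mul]
      exact ENNReal.mul_ne_top ENNReal.ofReal_ne_top (measure_ne_top ρ _)
    have h := (hQ s hs).one_sub_measureReal_count_eq_zero_le MeasurableSet.univ hfin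
    rw [Measure.smul_apply, smul_eq_mul, ENNReal.toReal_mul, ENNReal.toReal_ofReal hs,
      ← measureReal_def] at h
    rwa [probReal_compl_eq_one_sub hAm]
  have hSm : MeasurableSet
      (Prod.snd ⁻¹' {c : PointConfig E | c.count univ = 0}ᶜ :
        Set (PointConfig E × PointConfig E)) :=
    measurable_snd hAm.compl
  have hS : (P'.prod (Q s)).real (Prod.snd ⁻¹' {c : PointConfig E | c.count univ = 0}ᶜ) =
      P.real univ * (Q s).real {c : PointConfig E | c.count univ = 0}ᶜ := by
    rw [← Set.univ_prod, measureReal_prod_prod, hP'univ]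
  -- pointwise: superposing the extra sample changes `F` only if it is non-empty, by `≤ 2M`
  have hDb : ∀ p : PointConfig E × PointConfig E, ‖F (p.1 ∪ p.2) - F p.1‖ ≤
      (Prod.snd ⁻¹' {c : PointConfig E | c.count univ = 0}ᶜ).indicator (fun _ => 2 * M) p := by
    intro p
    by_cases hp : p ∈ Prod.snd ⁻¹' {c : PointConfig E | c.count univ = 0}ᶜ
    · rw [indicator_of_mem hp, Real.norm_eq_abs]
      calc |F (p.1 ∪ p.2) - F p.1| ≤ |F (p.1 ∪ p.2)| + |F p.1| := abs_sub _ _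
        _ ≤ M + M := add_le_add (hFb _) (hFb _)
        _ = 2 * M := by ring
    · have hp2 : p.2 = ∅ := by
        refine eq_empty_of_count_univ_eq_zero ?_
        simpa only [Set.mem_preimage, Set.mem_compl_iff, Set.mem_setOf_eq, not_not] using hp
      rw [indicator_of_notMem hp, hp2, union_empty_pointConfig, sub_self, norm_zero]
  -- integrate
  have hFi : ∀ {g : PointConfig E × PointConfig E → PointConfig E}, Measurable g →
      Integrable (fun p => F (g p)) (P'.prod (Q s)) := fun hg =>
    Integrable.of_bound (hFm.comp hg).aestronglyMeasurable M
      (Eventually.of_forall fun p => by rw [Real.norm_eq_abs]; exact hFb _)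
  have hIS : Integrable
      ((Prod.snd ⁻¹' {c : PointConfig E | c.count univ = 0}ᶜ).indicator fun _ => 2 * M)
      (P'.prod (Q s)) :=
    (integrable_const _).indicator hSm
  have hle := norm_integral_le_of_norm_le hIS (Eventually.of_forall hDb)
  rw [integral_sub (hFi hU) (hFi measurable_fst), integral_indicator_const _ hSm, smul_eq_mul,
    Real.norm_eq_abs] at hle
  rw [h1, h2]
  calc _ ≤ _ := hle
    _ = 2 * M * P.real univ * (Q s).real {c : PointConfig E | c.count univ = 0}ᶜ := by
        rw [hS]; ring
    _ ≤ 2 * M * P.real univ * (s * ρ.real univ) :=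
        mul_le_mul_of_nonneg_left hQA (mul_nonneg (mul_nonneg zero_le_two hM) measureReal_nonneg)

/-- **Continuity of the annealed observable along the superposition leg.** Let `P` be any
finite law of a "rest" configuration, `ρ` a finite measure and `Q t` (for `t ≥ 0`) a Poisson
point process of intensity `t • ρ`. For bounded measurable `F`, the annealed observable
`t ↦ ∫ F(c ∪ c') d(P ⊗ Q_t)` is continuous on `[0, 1]`: it is Lipschitz there with constant
`2 M P(univ) ρ(univ)` by the one-sided bound `abs_integral_union_poisson_sub_le` (superposing an
extra `Q_s` changes the configuration only with probability `1 - e^{-s ρ(univ)} ≤ s ρ(univ)`).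
[folklore] -/
theorem continuousOn_integral_union_poisson
    (P : Measure (PointConfig E)) [IsFiniteMeasure P]
    (ρ : Measure E) [IsFiniteMeasure ρ]
    (Q : ℝ → Measure (PointConfig E))
    (hQ : ∀ t, 0 ≤ t → IsPoissonPointProcess ((ENNReal.ofReal t) • ρ) (Q t))
    (F : PointConfig E → ℝ) (hFm : Measurable F) (M : ℝ) (hFb : ∀ c, |F c| ≤ M) :
    ContinuousOn (fun t : ℝ => ∫ p, F (p.1 ∪ p.2) ∂(P.prod (Q t))) (Icc (0 : ℝ) 1) := by
  set C := 2 * M * P.real univ * ρ.real univ with hCdef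
  -- the one-sided Lipschitz bound, for `0 ≤ x ≤ y`
  have key : ∀ x y : ℝ, 0 ≤ x → x ≤ y →
      |(∫ p, F (p.1 ∪ p.2) ∂(P.prod (Q y))) - ∫ p, F (p.1 ∪ p.2) ∂(P.prod (Q x))| ≤
        C * (y - x) := by
    intro x y hx hxy
    have h := abs_integral_union_poisson_sub_le P ρ Q hQ F hFm M hFb hx (sub_nonneg.2 hxy)
    rw [add_sub_cancel] at h
    calc _ ≤ _ := h
      _ = C * (y - x) := by rw [hCdef]; ring
  have hL : LipschitzOnWith (Real.toNNReal C)
      (fun t : ℝ => ∫ p, F (p.1 ∪ p.2) ∂(P.prod (Q t))) (Icc (0 : ℝ) 1) := by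
    refine LipschitzOnWith.of_le_add_mul' C fun x hx y hy => ?_
    rw [Real.dist_eq]
    rcases le_total x y with hxy | hxy
    · have h := key x y hx.1 hxy
      rw [abs_of_nonpos (sub_nonpos.2 hxy)]
      linarith [neg_abs_le ((∫ p, F (p.1 ∪ p.2) ∂(P.prod (Q y))) -
        ∫ p, F (p.1 ∪ p.2) ∂(P.prod (Q x)))]
    · have h := key y x hy.1 hxy
      rw [abs_of_nonneg (sub_nonneg.2 hxy)]
      linarith [le_abs_self ((∫ p, F (p.1 ∪ p.2) ∂(P.prod (Q x))) -
        ∫ p, F (p.1 ∪ p.2) ∂(P.prod (Q y)))]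
  exact hL.continuousOn

end Poisson

end Summit.CriticalPhenomena.CardyFormulaZ2.Theorems

end
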